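import Mathlib

/-!
# Area-law slaving, complex part 14 — ANALYTICITY OF A RATIONAL SLIP PROFILE ON A HORIZONTAL STRIP (scalar layer)
# (`FilamentSkeletonRss`, child crux `TangentSkeletonNearStraight`, stmt-NavierStokesRegularity-28295, line
# `child_tangent_analytic_strip`, ∃-side of the registered stub `stub_analyticClosing`: the `StadiumAnalyticArea` conjunct)

Complex part 13 (`stadium_analytic_area_of_scaled_slip`) asks the Γ-free slip profile `W` to extend holomorphically to a strip
`{|Im s| < σ₀}` with `‖W′‖ ≤ M₀`, `‖W″‖ ≤ K₀` there, real on `ℝ`.  The straight datum's profile is (real part 10, `datum_slip_eq`)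
  `W(s) = s/2 + K + Σ_k (γ_k/2π)·n_k/q_k(s)`,   `q_k(s) = a_k + 2b_k s + c_k s²` (`= ‖d⁰_k + s·e_k‖²`),
with `q_k(x) ≥ ρ²` on `ℝ` (separation) and `c_k = ‖e_k‖² ≤ 1`.  This file is the SCALAR layer of its complexification — no vectors:

* `strip_isOpen`, `closedBall_subset_strip`, `strip_norm_deriv_le` — Cauchy's estimate between nested strips
  (`‖f‖ ≤ C` on `{|Im| < σ₁}` ⇒ `‖f′‖ ≤ C/(σ₁ − σ₂)` on `{|Im| < σ₂}`);
* `quad_re_lower`, `quad_ne_zero` — `Re(a + 2b s + c s²) ≥ ρ² − (Im s)²` when `q ≥ ρ²` on `ℝ` and `c ≤ 1`;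
* `partner_holo`, `partner_ofReal`, `partner_norm_le` — `n/q(s)` is holomorphic on `{|Im| < ρ}`, real on `ℝ`, `≤ 4|n|/(3ρ²)` in modulus
  on `{|Im| < ρ/2}`;
* `rationalProfile_*` — for `W(s) = s/2 + K + Σ_{k∈S} (γ_k/2π)·n_k/q_k(s)`: holomorphic on `{|Im| < ρ}`, `W ↑x = ↑(…)` on `ℝ`,
  and with `B = Σ |γ_k/2π|·4|n_k|/(3ρ²)`: `‖W′‖ ≤ 1/2 + 8B/ρ` and `‖W″‖ ≤ 64B/ρ²` on `{|Im| < ρ/4}`.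

HONEST FRAMING: textbook complex analysis serving a HYPOTHETICAL filament skeleton on the NEGATIVE side of a MODEL route; no registered
stub is closed by this file and nothing here bears on Navier–Stokes regularity or blow-up.  `--supports stmt-NavierStokesRegularity-28295`.
-/

set_option linter.dupNamespace false

noncomputable section

namespace Summit.NavierStokesRegularity.NavierStokesRegularity.Theorems.AreaLawSlavingHolo

open Set Metric Filter Real Finset
open scoped Topology BigOperators

/-! ## §1 Cauchy's estimate between nested horizontal strips -/

/-- A horizontal strip is open. [folklore] -/
theorem strip_isOpen (σ : ℝ) : IsOpen {s : ℂ | |s.im| < σ} :=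
  isOpen_lt (continuous_abs.comp Complex.continuous_im) continuous_const

/-- The closed disc of radius `σ₁ − σ₂` about a point of the `σ₂`-strip lies in the `σ₁`-strip. [folklore] -/
theorem closedBall_subset_strip {σ₁ σ₂ : ℝ} {z : ℂ} (hz : z ∈ {s : ℂ | |s.im| < σ₂}) :
    closedBall z (σ₁ - σ₂) ⊆ {s : ℂ | |s.im| < σ₁} := by
  intro ζ hζ
  rw [mem_closedBall, dist_eq_norm] at hζ
  have him : |ζ.im - z.im| ≤ σ₁ - σ₂ := by
    have h := Complex.abs_im_le_norm (ζ - z)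
    rw [Complex.sub_im] at h
    exact h.trans hζ
  show |ζ.im| < σ₁
  have hz' : |z.im| < σ₂ := hz
  calc |ζ.im| = |(ζ.im - z.im) + z.im| := by ring_nf
    _ ≤ |ζ.im - z.im| + |z.im| := abs_add_le _ _
    _ < σ₁ := by linarith

/-- **Cauchy's estimate between nested strips.**  `f` holomorphic on `{|Im| < σ₁}` with `‖f‖ ≤ C` there, `σ₂ < σ₁`: then
`‖f′ z‖ ≤ C/(σ₁ − σ₂)` on `{|Im| < σ₂}`. [folklore: Cauchy] -/
theorem strip_norm_deriv_le {E : Type*} [NormedAddCommGroup E] [NormedSpace ℂ E] {σ₁ σ₂ C : ℝ} (hσ : σ₂ < σ₁)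
    {f : ℂ → E} (hf : DifferentiableOn ℂ f {s : ℂ | |s.im| < σ₁}) (hC : ∀ s ∈ {s : ℂ | |s.im| < σ₁}, ‖f s‖ ≤ C)
    {z : ℂ} (hz : z ∈ {s : ℂ | |s.im| < σ₂}) : ‖deriv f z‖ ≤ C / (σ₁ - σ₂) := by
  have hsub := closedBall_subset_strip (σ₁ := σ₁) hz
  have hd : DiffContOnCl ℂ f (ball z (σ₁ - σ₂)) := hf.diffContOnCl_ball hsub
  exact Complex.norm_deriv_le_of_forall_mem_sphere_norm_le (by linarith) hd
    (fun ζ hζ => hC ζ (hsub (sphere_subset_closedBall hζ)))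

/-! ## §2 The complex quadratic `q(s) = a + 2bs + cs²` and the partner term `n/q` -/

/-- Real part of the complexified quadratic: `Re q(x + iy) = q(x) − c y²`. [folklore] -/
theorem quad_re (a b c : ℝ) (s : ℂ) :
    ((a : ℂ) + 2 * (b : ℂ) * s + (c : ℂ) * s ^ 2).re = (a + 2 * b * s.re + c * s.re ^ 2) - c * s.im ^ 2 := by
  simp [sq, Complex.add_re, Complex.mul_re, Complex.mul_im]
  ring

/-- Lower bound on the real part: if `q ≥ ρ²` on `ℝ` and `c ≤ 1` then `Re q(s) ≥ ρ² − (Im s)²`. [folklore] -/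
theorem quad_re_lower {a b c ρ : ℝ} (hq : ∀ x : ℝ, ρ ^ 2 ≤ a + 2 * b * x + c * x ^ 2) (hc : c ≤ 1) (s : ℂ) :
    ρ ^ 2 - s.im ^ 2 ≤ ((a : ℂ) + 2 * (b : ℂ) * s + (c : ℂ) * s ^ 2).re := by
  rw [quad_re]
  nlinarith [hq s.re, sq_nonneg s.im]

/-- On the strip `{|Im| < ρ}` the quadratic does not vanish and `‖q(s)‖ ≥ ρ² − (Im s)² > 0`. [folklore] -/
theorem quad_norm_lower {a b c ρ : ℝ} (hq : ∀ x : ℝ, ρ ^ 2 ≤ a + 2 * b * x + c * x ^ 2) (hc : c ≤ 1) {s : ℂ}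
    (hs : |s.im| < ρ) :
    0 < ρ ^ 2 - s.im ^ 2 ∧ ρ ^ 2 - s.im ^ 2 ≤ ‖(a : ℂ) + 2 * (b : ℂ) * s + (c : ℂ) * s ^ 2‖ := by
  have h1 : s.im ^ 2 < ρ ^ 2 := by
    have hρ : 0 < ρ := lt_of_le_of_lt (abs_nonneg _) hs
    calc s.im ^ 2 = |s.im| ^ 2 := (sq_abs _).symm
      _ < ρ ^ 2 := by exact pow_lt_pow_left₀ hs (abs_nonneg _) two_ne_zero
  exact ⟨by linarith, (quad_re_lower hq hc s).trans (Complex.re_le_norm _)⟩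

/-- The quadratic is nonzero on the strip. [folklore] -/
theorem quad_ne_zero {a b c ρ : ℝ} (hq : ∀ x : ℝ, ρ ^ 2 ≤ a + 2 * b * x + c * x ^ 2) (hc : c ≤ 1) {s : ℂ}
    (hs : |s.im| < ρ) : (a : ℂ) + 2 * (b : ℂ) * s + (c : ℂ) * s ^ 2 ≠ 0 := by
  intro h
  have := (quad_norm_lower hq hc hs)
  rw [h, norm_zero] at this
  linarith [this.1, this.2]

/-- The partner term `n/q` is holomorphic on the strip `{|Im| < ρ}`. [folklore] -/
theorem partner_holo {a b c ρ : ℝ} (n : ℝ) (hq : ∀ x : ℝ, ρ ^ 2 ≤ a + 2 * b * x + c * x ^ 2) (hc : c ≤ 1) :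
    DifferentiableOn ℂ (fun s : ℂ => (n : ℂ) / ((a : ℂ) + 2 * (b : ℂ) * s + (c : ℂ) * s ^ 2)) {s : ℂ | |s.im| < ρ} := by
  intro s hs
  refine DifferentiableAt.differentiableWithinAt ?_
  refine (differentiableAt_const _).div ?_ (quad_ne_zero hq hc hs)
  fun_prop

/-- The partner term is real on `ℝ`: `n/q(↑x) = ↑(n/q(x))`. [folklore] -/
theorem partner_ofReal (n a b c : ℝ) (x : ℝ) :
    (n : ℂ) / ((a : ℂ) + 2 * (b : ℂ) * (x : ℂ) + (c : ℂ) * (x : ℂ) ^ 2) = ((n / (a + 2 * b * x + c * x ^ 2) : ℝ) : ℂ) := by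
  push_cast; ring

/-- Modulus bound on the half-strip: `|Im s| < ρ/2` ⇒ `‖n/q(s)‖ ≤ 4|n|/(3ρ²)`. [folklore] -/
theorem partner_norm_le {a b c ρ : ℝ} (n : ℝ) (hq : ∀ x : ℝ, ρ ^ 2 ≤ a + 2 * b * x + c * x ^ 2) (hc : c ≤ 1) (hρ : 0 < ρ)
    {s : ℂ} (hs : |s.im| < ρ / 2) :
    ‖(n : ℂ) / ((a : ℂ) + 2 * (b : ℂ) * s + (c : ℂ) * s ^ 2)‖ ≤ 4 * |n| / (3 * ρ ^ 2) := by
  have hs' : |s.im| < ρ := by linarith [abs_nonneg s.im]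
  obtain ⟨hpos, hlow⟩ := quad_norm_lower hq hc hs'
  have him2 : s.im ^ 2 < (ρ / 2) ^ 2 := by
    calc s.im ^ 2 = |s.im| ^ 2 := (sq_abs _).symm
      _ < (ρ / 2) ^ 2 := pow_lt_pow_left₀ hs (abs_nonneg _) two_ne_zero
  have h34 : 3 * ρ ^ 2 / 4 ≤ ‖(a : ℂ) + 2 * (b : ℂ) * s + (c : ℂ) * s ^ 2‖ := by linarith
  rw [norm_div, Complex.norm_real, Real.norm_eq_abs]
  rw [div_le_div_iff₀ (by linarith) (by positivity)]
  nlinarith [abs_nonneg n, h34]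

/-! ## §3 The rational profile `W(s) = s/2 + K + Σ (γ_k/2π)·n_k/q_k(s)` -/

/-- **Holomorphy of the rational profile** on the strip `{|Im| < ρ}`. [folklore] -/
theorem rationalProfile_holo {ι : Type*} (S : Finset ι) (γ n a b c : ι → ℝ) (K ρ : ℝ)
    (hq : ∀ k ∈ S, ∀ x : ℝ, ρ ^ 2 ≤ a k + 2 * b k * x + c k * x ^ 2) (hc : ∀ k ∈ S, c k ≤ 1) :
    DifferentiableOn ℂ (fun s : ℂ => s / 2 + (K : ℂ) +
      ∑ k ∈ S, (γ k / (2 * Real.pi) : ℂ) * ((n k : ℂ) / ((a k : ℂ) + 2 * (b k : ℂ) * s + (c k : ℂ) * s ^ 2)))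
      {s : ℂ | |s.im| < ρ} := by
  refine DifferentiableOn.add (by fun_prop) ?_
  refine DifferentiableOn.fun_sum (u := S) fun k hk => ?_
  exact (differentiableOn_const _).mul (partner_holo (n k) (hq k hk) (hc k hk))

/-- **Real trace of the rational profile.** [folklore] -/
theorem rationalProfile_ofReal {ι : Type*} (S : Finset ι) (γ n a b c : ι → ℝ) (K : ℝ) (x : ℝ) :
    ((x : ℂ) / 2 + (K : ℂ) +
      ∑ k ∈ S, (γ k / (2 * Real.pi) : ℂ) * ((n k : ℂ) / ((a k : ℂ) + 2 * (b k : ℂ) * (x : ℂ) + (c k : ℂ) * (x : ℂ) ^ 2))) =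
      ((x / 2 + K + ∑ k ∈ S, γ k / (2 * Real.pi) * (n k / (a k + 2 * b k * x + c k * x ^ 2)) : ℝ) : ℂ) := by
  push_cast
  rfl

/-- **Bound on the partner sum** on the half-strip: `‖Σ (γ_k/2π)·n_k/q_k(s)‖ ≤ B = Σ |γ_k/2π|·4|n_k|/(3ρ²)`. [folklore] -/
theorem rationalProfile_sum_norm_le {ι : Type*} (S : Finset ι) (γ n a b c : ι → ℝ) {ρ : ℝ} (hρ : 0 < ρ)
    (hq : ∀ k ∈ S, ∀ x : ℝ, ρ ^ 2 ≤ a k + 2 * b k * x + c k * x ^ 2) (hc : ∀ k ∈ S, c k ≤ 1)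
    {s : ℂ} (hs : |s.im| < ρ / 2) :
    ‖∑ k ∈ S, (γ k / (2 * Real.pi) : ℂ) * ((n k : ℂ) / ((a k : ℂ) + 2 * (b k : ℂ) * s + (c k : ℂ) * s ^ 2))‖ ≤
      ∑ k ∈ S, |γ k / (2 * Real.pi)| * (4 * |n k| / (3 * ρ ^ 2)) := by
  refine (norm_sum_le _ _).trans (Finset.sum_le_sum fun k hk => ?_)
  rw [norm_mul]
  have h1 : ‖(γ k / (2 * Real.pi) : ℂ)‖ = |γ k / (2 * Real.pi)| := by
    rw [show (γ k / (2 * Real.pi) : ℂ) = ((γ k / (2 * Real.pi) : ℝ) : ℂ) by push_cast; ring, Complex.norm_real,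
      Real.norm_eq_abs]
  rw [h1]
  exact mul_le_mul_of_nonneg_left (partner_norm_le (n k) (hq k hk) (hc k hk) hρ hs) (abs_nonneg _)

/-- **Derivative bounds of the rational profile on the quarter-strip.**  With `B = Σ |γ_k/2π|·4|n_k|/(3ρ²)`:
`‖W′‖ ≤ 1/2 + 8B/ρ` and `‖W″‖ ≤ 64B/ρ²` on `{|Im| < ρ/4}` (Cauchy twice: `ρ/2 → 3ρ/8 → ρ/4`). [folklore] -/
theorem rationalProfile_deriv_bounds {ι : Type*} (S : Finset ι) (γ n a b c : ι → ℝ) (K : ℝ) {ρ : ℝ} (hρ : 0 < ρ)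
    (hq : ∀ k ∈ S, ∀ x : ℝ, ρ ^ 2 ≤ a k + 2 * b k * x + c k * x ^ 2) (hc : ∀ k ∈ S, c k ≤ 1) :
    ∀ z ∈ {s : ℂ | |s.im| < ρ / 4},
      ‖deriv (fun s : ℂ => s / 2 + (K : ℂ) +
          ∑ k ∈ S, (γ k / (2 * Real.pi) : ℂ) * ((n k : ℂ) / ((a k : ℂ) + 2 * (b k : ℂ) * s + (c k : ℂ) * s ^ 2))) z‖ ≤
        1 / 2 + 8 * (∑ k ∈ S, |γ k / (2 * Real.pi)| * (4 * |n k| / (3 * ρ ^ 2))) / ρ ∧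
      ‖deriv (deriv (fun s : ℂ => s / 2 + (K : ℂ) +
          ∑ k ∈ S, (γ k / (2 * Real.pi) : ℂ) * ((n k : ℂ) / ((a k : ℂ) + 2 * (b k : ℂ) * s + (c k : ℂ) * s ^ 2)))) z‖ ≤
        64 * (∑ k ∈ S, |γ k / (2 * Real.pi)| * (4 * |n k| / (3 * ρ ^ 2))) / ρ ^ 2 := by
  -- notation: the partner sum `R` and its bound `B`
  set B : ℝ := ∑ k ∈ S, |γ k / (2 * Real.pi)| * (4 * |n k| / (3 * ρ ^ 2)) with hB
  set R : ℂ → ℂ := fun s => ∑ k ∈ S, (γ k / (2 * Real.pi) : ℂ) *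
    ((n k : ℂ) / ((a k : ℂ) + 2 * (b k : ℂ) * s + (c k : ℂ) * s ^ 2)) with hR
  have hRholo : ∀ σ, σ ≤ ρ → DifferentiableOn ℂ R {s : ℂ | |s.im| < σ} := by
    intro σ hσ
    have h : DifferentiableOn ℂ R {s : ℂ | |s.im| < ρ} := by
      rw [hR]
      refine DifferentiableOn.fun_sum (u := S) fun k hk => ?_
      exact (differentiableOn_const _).mul (partner_holo (n k) (hq k hk) (hc k hk))
    exact h.mono fun s (hs : |s.im| < σ) => show |s.im| < ρ from lt_of_lt_of_le hs hσ
  -- first derivative of `R` on the `3ρ/8`-strip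
  have hR' : ∀ z ∈ {s : ℂ | |s.im| < 3 * ρ / 8}, ‖deriv R z‖ ≤ B / (ρ / 2 - 3 * ρ / 8) := by
    intro z hz
    exact strip_norm_deriv_le (by linarith) (hRholo (ρ / 2) (by linarith))
      (fun s hs => by rw [hR]; exact rationalProfile_sum_norm_le S γ n a b c hρ hq hc hs) hz
  have hR'' : ∀ z ∈ {s : ℂ | |s.im| < ρ / 4}, ‖deriv (deriv R) z‖ ≤ (B / (ρ / 2 - 3 * ρ / 8)) / (3 * ρ / 8 - ρ / 4) := by
    intro z hz
    have hdR : DifferentiableOn ℂ (deriv R) {s : ℂ | |s.im| < 3 * ρ / 8} :=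
      ((hRholo (3 * ρ / 8) (by linarith)).analyticOnNhd (strip_isOpen _)).deriv.differentiableOn
    exact strip_norm_deriv_le (by linarith) hdR hR' hz
  -- the profile `W = (s/2 + K) + R`
  have hWd : ∀ z ∈ {s : ℂ | |s.im| < ρ}, HasDerivAt (fun s : ℂ => s / 2 + (K : ℂ) + R s) (1 / 2 + deriv R z) z := by
    intro z hz
    have h1 : HasDerivAt (fun s : ℂ => s / 2 + (K : ℂ)) (1 / 2) z := by
      simpa using ((hasDerivAt_id z).div_const (2 : ℂ)).add_const (K : ℂ)
    have h2 : HasDerivAt R (deriv R z) z :=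
      ((hRholo ρ le_rfl).differentiableAt ((strip_isOpen ρ).mem_nhds hz)).hasDerivAt
    exact h1.add h2
  intro z hz
  have hz' : z ∈ {s : ℂ | |s.im| < ρ} := show |z.im| < ρ by
    have : |z.im| < ρ / 4 := hz
    linarith [abs_nonneg z.im]
  have hz38 : z ∈ {s : ℂ | |s.im| < 3 * ρ / 8} := show |z.im| < 3 * ρ / 8 by
    have : |z.im| < ρ / 4 := hz
    linarith
  have hfun : (fun s : ℂ => s / 2 + (K : ℂ) +
      ∑ k ∈ S, (γ k / (2 * Real.pi) : ℂ) * ((n k : ℂ) / ((a k : ℂ) + 2 * (b k : ℂ) * s + (c k : ℂ) * s ^ 2))) =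
      fun s : ℂ => s / 2 + (K : ℂ) + R s := by rw [hR]
  rw [hfun]
  constructor
  · rw [(hWd z hz').deriv]
    have h8 : B / (ρ / 2 - 3 * ρ / 8) = 8 * B / ρ := by field_simp; ring
    calc ‖(1 / 2 : ℂ) + deriv R z‖ ≤ ‖(1 / 2 : ℂ)‖ + ‖deriv R z‖ := norm_add_le _ _
      _ ≤ 1 / 2 + 8 * B / ρ := by
          have : ‖(1 / 2 : ℂ)‖ = 1 / 2 := by norm_num
          rw [this, ← h8]; linarith [hR' z hz38]
  · -- `deriv W = 1/2 + deriv R` near `z`, so `deriv (deriv W) z = deriv (deriv R) z`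
    have hev : deriv (fun s : ℂ => s / 2 + (K : ℂ) + R s) =ᶠ[𝓝 z] fun s => 1 / 2 + deriv R s :=
      Filter.eventually_of_mem ((strip_isOpen ρ).mem_nhds hz') (fun s hs => (hWd s hs).deriv)
    rw [hev.deriv_eq]
    have hd2 : deriv (fun s => (1 / 2 : ℂ) + deriv R s) z = deriv (deriv R) z := by
      rw [deriv_const_add]
    rw [hd2]
    have h64 : (B / (ρ / 2 - 3 * ρ / 8)) / (3 * ρ / 8 - ρ / 4) = 64 * B / ρ ^ 2 := by field_simp; ring
    rw [← h64]
    exact hR'' z hz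

end Summit.NavierStokesRegularity.NavierStokesRegularity.Theorems.AreaLawSlavingHolo
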